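import Mathlib.RingTheory.Ideal.Height
import Mathlib.RingTheory.Ideal.GoingUp
import Mathlib.RingTheory.Localization.AtPrime.Basic
import Literature.RingTheory.KrullDimension.AffineDimension
import HarnessLib

/-!
# Local dimensions are preserved under integral extensions of a subalgebra
(crux `FInjectiveMacaulayfication`, line `Sketch`)

Support file for crux stmt-ResolutionOfSingularities-15315 (`FrobeniusLadder.FInjectiveMacaulayfication`,
line `Sketch`), stub `stub_integralSubalgebraLocalDim` of the cycle-9 WEIGHTED CONE ENGINE (§15 of the
registered skeleton 10f06f91). In the engine `B = k[X]/(g)` is a graded hypersurface ring all of whose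
local rings at maximal ideals have dimension `m`, and `A ⊆ B` is the `k`-subalgebra of weighted-degree-`0`
classes, over which `B` is integral (`stub_subalgebraIntegralOfPow`); the stub transfers the local
dimension `m` to every maximal ideal of `A` (finite graded descent of the Cohen–Macaulay / F-injective
clause needs `dim A_𝔫 = dim B_Q`).

* `stub_integralSubalgebraLocalDim` — `A ⊆ B` a `k`-subalgebra with `B` integral over `A`; if
  `dim B_Q = m` for every maximal ideal `Q` of `B`, then `dim A_𝔫 = m` for every maximal ideal `𝔫` of `A`.

Proof: `dim R_𝔭 = ht 𝔭` (`IsLocalization.AtPrime.ringKrullDim_eq_height`). `ht 𝔫 ≤ m`: a chain of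
primes ending at `𝔫` lifts (going-up for chains, `Literature.RingTheory.KrullDimension.exists_ltSeries_of_isIntegral`)
to a chain of the same length ending at a prime `Q` over `𝔫`, which is maximal
(`Ideal.isMaximal_of_isIntegral_of_isMaximal_comap`), so the length is `≤ ht Q = m`. `m ≤ ht 𝔫`: pick a
maximal `Q` over `𝔫` (`Ideal.exists_ideal_over_maximal_of_isIntegral`); contraction of primes is strictly
monotone (incomparability, `Ideal.IsIntegral.comap_lt_comap`), so `m = ht Q ≤ ht 𝔫`
(`Order.height_le_height_apply_of_strictMono`). The noetherian hypothesis of the registered signature is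
not used. [folklore; Matsumura, *Commutative Ring Theory*, Thm 9.3/9.4]
-/

-- single-problem summit: the doubled namespace component is forced
set_option linter.dupNamespace false

namespace Summit.ResolutionOfSingularities.ResolutionOfSingularities.Theorems.FInjectiveMacaulayfication.IntegralSubalgebraLocalDim

open Literature.RingTheory.KrullDimension

/-- For an injective integral extension `R → S` and a maximal ideal `𝔫` of `R`: if every maximal ideal
of `S` has height `m`, then `𝔫` has height `m` (going-up for chains + incomparability). [folklore] -/
theorem height_eq_of_isIntegral_of_forall_isMaximal {R S : Type*} [CommRing R] [CommRing S]
    [Algebra R S] [Algebra.IsIntegral R S] (hinj : Function.Injective (algebraMap R S)) (m : ℕ)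
    (hS : ∀ (Q : Ideal S) [Q.IsMaximal], Q.height = m) (𝔫 : Ideal R) [𝔫.IsMaximal] :
    𝔫.height = m := by
  have e𝔫 : 𝔫.height = Order.height (⟨𝔫, inferInstance⟩ : PrimeSpectrum R) :=
    PrimeSpectrum.height_eq_orderHeight ⟨𝔫, inferInstance⟩
  apply le_antisymm
  · -- `ht 𝔫 ≤ m`: going-up for chains
    rw [e𝔫]
    refine Order.height_le fun p hp => ?_
    obtain ⟨q, hlen, hlast⟩ := exists_ltSeries_of_isIntegral hinj p
    have hp' : p.last.asIdeal = 𝔫 := by rw [hp]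
    rw [hp'] at hlast
    haveI : q.last.asIdeal.IsMaximal :=
      Ideal.isMaximal_of_isIntegral_of_isMaximal_comap (R := R) q.last.asIdeal (hlast.symm ▸ inferInstance)
    have hQ : q.last.asIdeal.height = m := hS q.last.asIdeal
    calc (p.length : ℕ∞) = q.length := by rw [hlen]
      _ ≤ Order.height q.last := Order.length_le_height_last
      _ = q.last.asIdeal.height := (PrimeSpectrum.height_eq_orderHeight q.last).symm
      _ = m := hQ
  · -- `m ≤ ht 𝔫`: a maximal ideal over `𝔫` and incomparability
    have hker : RingHom.ker (algebraMap R S) ≤ 𝔫 := by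
      rw [(RingHom.injective_iff_ker_eq_bot _).1 hinj]
      exact bot_le
    obtain ⟨Q, hQmax, hQ𝔫⟩ := Ideal.exists_ideal_over_maximal_of_isIntegral 𝔫 hker
    have hmono : StrictMono
        (fun P : PrimeSpectrum S => PrimeSpectrum.comap (algebraMap R S) P) :=
      fun _ _ h => Ideal.IsIntegral.comap_lt_comap h
    have hcomap : PrimeSpectrum.comap (algebraMap R S) ⟨Q, hQmax.isPrime⟩ =
        (⟨𝔫, inferInstance⟩ : PrimeSpectrum R) := PrimeSpectrum.ext hQ𝔫
    calc (m : ℕ∞) = Q.height := (hS Q).symm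
      _ = Order.height (⟨Q, hQmax.isPrime⟩ : PrimeSpectrum S) :=
          PrimeSpectrum.height_eq_orderHeight ⟨Q, hQmax.isPrime⟩
      _ ≤ Order.height (PrimeSpectrum.comap (algebraMap R S) ⟨Q, hQmax.isPrime⟩) :=
          Order.height_le_height_apply_of_strictMono _ hmono _
      _ = 𝔫.height := by rw [hcomap, e𝔫]

/-- **`stub_integralSubalgebraLocalDim`** (registered signature, skeleton 10f06f91 of crux
stmt-ResolutionOfSingularities-15315): `A ⊆ B` a `k`-subalgebra with `B` integral over `A`; if every
localization of `B` at a maximal ideal has Krull dimension `m`, then so does every localization of `A`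
at a maximal ideal. (`IsNoetherianRing B` is part of the registered signature and is not used.)
[folklore; Matsumura Thm 9.3/9.4] -/
theorem stub_integralSubalgebraLocalDim : ∀ (k B : Type) [Field k] [CommRing B] [Algebra k B]
    [IsNoetherianRing B] (A : Subalgebra k B) [Algebra.IsIntegral A B] (m : ℕ),
    (∀ (Q : Ideal B) [Q.IsMaximal], ringKrullDim (Localization.AtPrime Q) = m) →
    ∀ (𝔫 : Ideal A) [𝔫.IsMaximal], ringKrullDim (Localization.AtPrime 𝔫) = m := by
  intro k B _ _ _ _ A _ m hB 𝔫 _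
  have hinj : Function.Injective (algebraMap A B) := Subtype.val_injective
  have hS : ∀ (Q : Ideal B) [Q.IsMaximal], Q.height = m := by
    intro Q _
    have h := hB Q
    rw [IsLocalization.AtPrime.ringKrullDim_eq_height Q (Localization.AtPrime Q)] at h
    exact_mod_cast h
  rw [IsLocalization.AtPrime.ringKrullDim_eq_height 𝔫 (Localization.AtPrime 𝔫),
    height_eq_of_isIntegral_of_forall_isMaximal hinj m hS 𝔫]
  rfl

end Summit.ResolutionOfSingularities.ResolutionOfSingularities.Theorems.FInjectiveMacaulayfication.IntegralSubalgebraLocalDim
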